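import Literature.Computability.Complexity.CircuitSemantics
import Literature.Computability.Complexity.SymmetricCircuit
import Literature.ModelTheory.FiniteModelTheory.SymmetricCircuitCountingWidth
import HarnessLib

/-!
# Boolean circuits as labelled DAGs on an arbitrary gate type, and their compilation to
# straight-line programs

Support file (everything PROVED, no named facts) for the rigidification of symmetric circuits
(`CircuitReduce.lean`, Anderson–Dawar 2017, Lemma 7) and for the arithmetic-to-threshold
translation of Dawar–Wilsenach 2025, Thm. 5.1. The tree's `Circuit ι` (`Circuit.lean`) is a
straight-line program: a LIST of gates with back-references by position. Constructions that
merge, duplicate or re-index gates are painful in that format; here a circuit is a DAG on an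
arbitrary (finite) gate type `Λ`:

* `GateDAG ι Λ` — `fn : Λ → GateFn`, `args l : Fin (fn l).1 → ι ⊕ Λ` (input wires `inl i`, gate
  wires `inr m`), an output wire, and well-foundedness of the child relation (acyclicity);
* `GateDAG.val D x l` — the value of gate `l` on input `x` (well-founded recursion), `evalOut`;
* `GateDAG.compile D : Circuit ι` — the straight-line program listing the gates along a
  topological enumeration `topo : Λ ≃ Fin |Λ|` (children before parents), with
  `compile_eval : (compile D).eval x = D.evalOut x`, `IsOver`, `HasSimpleWiring`;
* `GateDAG.IsAut D π θ` — automorphisms (a bijection `θ` of the gates over a map `π` of the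
  inputs: output fixed, gate functions preserved, argument lists permuted-and-relabelled, the DAG
  form of `Circuit.IsInducedAut`), with `isInducedAut_compile_iff`; hence symmetry
  (`IsSymmetricUnder`), rigidity (`IsRigid`) and gate orbits (`gateOrbit`, `orbitSize`) of the
  compiled program are read off the DAG (`gateOrbit_compile`, `orbitSize_compile_le` …);
* `GateDAG.Reduced` (no two gates with the same gate function and the same multiset of argument
  wires) implies uniqueness of the automorphism over a given `π` (`IsAut.unique`), i.e. rigidity
  (Anderson–Dawar 2017, Prop. 9: syntactic rigidity implies rigidity);
* `GateDAG.ofCircuit C` — a straight-line program read as a DAG on `Fin |C|`, with the same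
  values, automorphisms and orbits (`val_ofCircuit`, `isAut_ofCircuit_iff`, `orbitSize_ofCircuit`).

## References

* M. Anderson, A. Dawar, *On symmetric circuits and fixed-point logics*, Theory Comput. Syst. 60
  (2017), Def. 4–8, Prop. 9 (rigidity of reduced circuits), Lemma 7.
* A. Dawar, G. Wilsenach, *Symmetric arithmetic circuits*, Theory of Computing 21 (2025), §2.5,
  §3.2 (automorphisms, orbits).
* S. Arora, B. Barak, *Computational Complexity* (2009), Def. 6.1, Rem. 6.4 (straight-line programs).
-/

noncomputable section

namespace Literature.Computability.Complexity

open Finset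

/-- Transport of a statement about all argument wires along an equality of gates. [folklore] -/
theorem Gate.forall_args_iff_of_eq {ι : Type*} {g g' : Gate ι} (h : g = g') (P : ι ⊕ ℕ → Prop) :
    (∀ a, P (g.args a)) ↔ ∀ a, P (g'.args a) := by
  subst h; exact Iff.rfl

/-- Transport of injectivity of the argument map along an equality of gates. [folklore] -/
theorem Gate.injective_args_iff_of_eq {ι : Type*} {g g' : Gate ι} (h : g = g') :
    Function.Injective g.args ↔ Function.Injective g'.args := by
  subst h; exact Iff.rfl

/-- Equal gate functions, one of them symmetric, agree on argument tuples with the same number of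
ones. [folklore] -/
theorem GateFn.apply_eq_of_eq {f g : GateFn} (hfg : f = g) (hg : g.IsSymmetric)
    {v : Fin f.1 → Bool} {w : Fin g.1 → Bool} (h : GateFn.numOnes v = GateFn.numOnes w) :
    f.2 v = g.2 w := by
  subst hfg; exact hg v w h

/-- Transport of the argument list along an equality of gates. [folklore] -/
theorem Gate.ofFn_args_eq_of_eq {ι : Type*} {g g' : Gate ι} (h : g = g') :
    List.ofFn g.args = List.ofFn g'.args := by
  subst h; rfl

/-- **A Boolean circuit as a labelled DAG** on the gate type `Λ` over input variables `ι`: every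
gate has a gate function (arity and truth table) and, for each argument position, a wire — an
input `inl i` or a gate `inr m` —, there is an output wire, and the child relation is well
founded (acyclicity). [Anderson–Dawar 2017, Def. 4 (circuits as labelled DAGs); Arora–Barak 2009,
Def. 6.1] [cite: AndersonDawar2016, Def. 4] -/
structure GateDAG (ι : Type*) (Λ : Type*) where
  /-- The gate function of a gate. -/
  fn : Λ → GateFn
  /-- The wires feeding a gate. -/
  args : ∀ l : Λ, Fin (fn l).1 → ι ⊕ Λ
  /-- The output wire. -/
  out : ι ⊕ Λ
  /-- Acyclicity: the child relation is well founded. -/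
  wf : WellFounded fun m l : Λ => ∃ a, args l a = Sum.inr m

namespace GateDAG

variable {ι Λ : Type*} (D : GateDAG ι Λ)

/-- `m` is a child of `l`: some argument wire of `l` is the gate `m`. [folklore] -/
def Child (m l : Λ) : Prop := ∃ a, D.args l a = Sum.inr m

/-- The child relation is well founded. [folklore] -/
theorem wf_child : WellFounded D.Child := D.wf

/-! ### Semantics -/

/-- The value of a wire, given the input and the values of the gates. [folklore] -/
def wire (x : ι → Bool) (v : Λ → Bool) : ι ⊕ Λ → Bool := Sum.elim x v

/-- Value of an input wire. [folklore] -/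
@[simp] theorem wire_inl (x : ι → Bool) (v : Λ → Bool) (i : ι) : wire x v (Sum.inl i) = x i := rfl

/-- Value of a gate wire. [folklore] -/
@[simp] theorem wire_inr (x : ι → Bool) (v : Λ → Bool) (m : Λ) : wire x v (Sum.inr m) = v m := rfl

/-- **The value of a gate** on input `x`: its truth table applied to the values of its argument
wires (well-founded recursion along the wires). [Arora–Barak 2009, Def. 6.1] [folklore] -/
noncomputable def val (x : ι → Bool) : Λ → Bool :=
  D.wf.fix fun l rec => (D.fn l).2 fun a =>
    match h : D.args l a with
    | .inl i => x i
    | .inr m => rec m ⟨a, h⟩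

/-- The defining equation of `val`. [folklore] -/
theorem val_eq (x : ι → Bool) (l : Λ) :
    D.val x l = (D.fn l).2 fun a => wire x (D.val x) (D.args l a) := by
  show D.wf.fix _ l = _
  rw [WellFounded.fix_eq]
  refine congrArg (D.fn l).2 (funext fun a => ?_)
  split <;> rename_i h
  · simp [h]
  · simp only [h, wire_inr]; rfl

/-- The value computed at the output wire. [folklore] -/
noncomputable def evalOut (x : ι → Bool) : Bool := wire x (D.val x) D.out

/-! ### Height and topological enumerations -/

/-- The height of a gate: one more than the maximal height of a gate child (`0` if all arguments
are inputs). [folklore] -/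
noncomputable def height : Λ → ℕ :=
  D.wf.fix fun l rec => univ.sup fun a : Fin (D.fn l).1 =>
    match h : D.args l a with
    | .inl _ => 0
    | .inr m => rec m ⟨a, h⟩ + 1

/-- The defining equation of `height`. [folklore] -/
theorem height_eq (l : Λ) :
    D.height l = univ.sup fun a : Fin (D.fn l).1 =>
      Sum.elim (fun _ => 0) (fun m => D.height m + 1) (D.args l a) := by
  show D.wf.fix _ l = _
  rw [WellFounded.fix_eq]
  refine congrArg univ.sup (funext fun a => ?_)
  split <;> rename_i h
  · simp [h]
  · simp only [h, Sum.elim_inr]; rfl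

/-- Children have smaller height. [folklore] -/
theorem height_lt_of_child {m l : Λ} (h : D.Child m l) : D.height m < D.height l := by
  obtain ⟨a, ha⟩ := h
  rw [D.height_eq l]
  have : D.height m + 1 ≤ univ.sup fun a : Fin (D.fn l).1 =>
      Sum.elim (fun _ => 0) (fun m => D.height m + 1) (D.args l a) := by
    refine le_trans ?_ (Finset.le_sup (f := fun a : Fin (D.fn l).1 =>
      Sum.elim (fun _ => 0) (fun m => D.height m + 1) (D.args l a)) (mem_univ a))
    simp [ha]
  omega

section Topo

variable [Fintype Λ]

/-- **A topological enumeration exists**: a bijection `Λ ≃ Fin |Λ|` listing children before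
parents (sort by height, ties broken by an arbitrary enumeration). [folklore] -/
theorem exists_topo : ∃ e : Λ ≃ Fin (Fintype.card Λ), ∀ m l, D.Child m l → e m < e l := by
  classical
  let e₀ : Λ ≃ Fin (Fintype.card Λ) := Fintype.equivFin Λ
  let key : Λ → ℕ ×ₗ ℕ := fun l => toLex (D.height l, (e₀ l : ℕ))
  have hkey : Function.Injective key := by
    intro l l' h
    have h2 : (e₀ l : ℕ) = e₀ l' := (Prod.ext_iff.1 (toLex.injective h)).2
    exact e₀.injective (Fin.ext h2)
  let rk : Λ → ℕ := fun l => (univ.filter fun l' => key l' < key l).card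
  have hrk_lt : ∀ l, rk l < Fintype.card Λ := by
    intro l
    have : (univ.filter fun l' => key l' < key l) ⊂ univ := by
      rw [Finset.ssubset_iff_subset_ne]
      refine ⟨subset_univ _, fun h => ?_⟩
      have hl : l ∈ univ.filter fun l' => key l' < key l := by rw [h]; exact mem_univ l
      exact lt_irrefl _ (mem_filter.1 hl).2
    have := Finset.card_lt_card this
    rwa [Finset.card_univ] at this
  have hmono : ∀ l l', key l < key l' → rk l < rk l' := by
    intro l l' h
    apply Finset.card_lt_card
    rw [Finset.ssubset_iff_subset_ne]
    refine ⟨fun x hx => ?_, fun heq => ?_⟩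
    · rw [mem_filter] at hx ⊢
      exact ⟨hx.1, lt_trans hx.2 h⟩
    · have hl : l ∈ univ.filter fun x => key x < key l' := mem_filter.2 ⟨mem_univ _, h⟩
      rw [← heq] at hl
      exact lt_irrefl _ (mem_filter.1 hl).2
  have hinj : Function.Injective fun l => (⟨rk l, hrk_lt l⟩ : Fin (Fintype.card Λ)) := by
    intro l l' h
    simp only [Fin.mk.injEq] at h
    by_contra hne
    rcases lt_trichotomy (key l) (key l') with hlt | heq | hgt
    · exact absurd h (hmono l l' hlt).ne
    · exact hne (hkey heq)
    · exact absurd h (hmono l' l hgt).ne'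
  have hbij : Function.Bijective fun l => (⟨rk l, hrk_lt l⟩ : Fin (Fintype.card Λ)) := by
    rw [Fintype.bijective_iff_injective_and_card]
    exact ⟨hinj, by simp⟩
  refine ⟨Equiv.ofBijective _ hbij, fun m l hml => ?_⟩
  show (⟨rk m, _⟩ : Fin _) < ⟨rk l, _⟩
  rw [Fin.mk_lt_mk]
  apply hmono
  have := D.height_lt_of_child hml
  show toLex (D.height m, (e₀ m : ℕ)) < toLex (D.height l, (e₀ l : ℕ))
  exact Prod.Lex.toLex_lt_toLex.2 (Or.inl this)

/-- A fixed topological enumeration of the gates. [folklore] -/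
noncomputable def topo : Λ ≃ Fin (Fintype.card Λ) := D.exists_topo.choose

/-- Children come before parents in `topo`. [folklore] -/
theorem topo_lt_of_child {m l : Λ} (h : D.Child m l) : D.topo m < D.topo l :=
  D.exists_topo.choose_spec m l h

end Topo

/-! ### Compilation to a straight-line program -/

section Compile

variable [Fintype Λ]

/-- The relabelling of wires along the topological enumeration: gate `m` becomes the
back-reference `topo m`. [folklore] -/
def cwire (w : ι ⊕ Λ) : ι ⊕ ℕ := w.map id fun m => (D.topo m : ℕ)

/-- `cwire` on an input wire. [folklore] -/
@[simp] theorem cwire_inl (i : ι) : D.cwire (Sum.inl i) = Sum.inl i := rfl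

/-- `cwire` on a gate wire. [folklore] -/
@[simp] theorem cwire_inr (m : Λ) : D.cwire (Sum.inr m) = Sum.inr (D.topo m : ℕ) := rfl

/-- `cwire` is injective. [folklore] -/
theorem cwire_injective : Function.Injective D.cwire := by
  rintro (i | m) (i' | m') h
  · rw [cwire_inl, cwire_inl] at h
    rw [Sum.inl_injective h]
  · rw [cwire_inl, cwire_inr] at h
    exact absurd h Sum.inl_ne_inr
  · rw [cwire_inr, cwire_inl] at h
    exact absurd h Sum.inr_ne_inl
  · rw [cwire_inr, cwire_inr, Sum.inr.injEq] at h
    exact congrArg Sum.inr (D.topo.injective (Fin.ext h))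

/-- The straight-line gate of the DAG gate `l`. [folklore] -/
def cgate (l : Λ) : Gate ι := ⟨(D.fn l).1, (D.fn l).2, fun a => D.cwire (D.args l a)⟩

/-- The gate function of a compiled gate. [folklore] -/
@[simp] theorem cgate_fn (l : Λ) : (D.cgate l).fn = D.fn l := rfl

/-- The wires of a compiled gate. [folklore] -/
theorem cgate_args (l : Λ) (a : Fin (D.fn l).1) : (D.cgate l).args a = D.cwire (D.args l a) := rfl

/-- Back-references of a compiled gate point to earlier positions. [folklore] -/
theorem cgate_args_lt (l : Λ) (a : Fin (D.cgate l).arity) (m : ℕ) (h : (D.cgate l).args a = Sum.inr m) :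
    m < D.topo l := by
  change D.cwire (D.args l a) = Sum.inr m at h
  cases hw : D.args l a with
  | inl i => rw [hw] at h; exact absurd h Sum.inl_ne_inr
  | inr m' =>
    rw [hw, cwire_inr, Sum.inr.injEq] at h
    rw [← h]
    exact D.topo_lt_of_child ⟨a, hw⟩

/-- **The compiled straight-line program**: the gates listed along `topo`. [Arora–Barak 2009,
Def. 6.1 / Rem. 6.4 (straight-line programs)] [folklore] -/
noncomputable def compile : Circuit ι where
  gates := List.ofFn fun k => D.cgate (D.topo.symm k)
  output := D.cwire D.out
  wf := by
    intro j hj a m h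
    have hj' : j < Fintype.card Λ := by simpa using hj
    have hg : (List.ofFn fun k => D.cgate (D.topo.symm k))[j] = D.cgate (D.topo.symm ⟨j, hj'⟩) := by
      simp
    have key := (Gate.forall_args_iff_of_eq hg (fun w => w = Sum.inr m → m < j)).2
      (fun a h => by
        have := D.cgate_args_lt _ a m h
        rwa [Equiv.apply_symm_apply] at this)
    exact key a h
  wf_output := by
    intro m h
    cases hw : D.out with
    | inl i => rw [hw] at h; exact absurd h Sum.inl_ne_inr
    | inr m' =>
      rw [hw, cwire_inr, Sum.inr.injEq] at h
      rw [List.length_ofFn, ← h]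
      exact (D.topo m').2

/-- The compiled program has one gate per DAG gate. [folklore] -/
@[simp] theorem compile_gates_length : D.compile.gates.length = Fintype.card Λ := by
  simp [compile]

/-- The gates of the compiled program. [folklore] -/
theorem compile_getElem {k : ℕ} (hk : k < D.compile.gates.length) :
    D.compile.gates[k] = D.cgate (D.topo.symm ⟨k, by simpa using hk⟩) := by
  simp [compile]

/-- The output wire of the compiled program. [folklore] -/
theorem compile_output : D.compile.output = D.cwire D.out := rfl

/-- The transcript of the compiled program lists the DAG values along `topo`. [folklore] -/
theorem transcript_compile (x : ι → Bool) :
    transcript x [] D.compile.gates = List.ofFn fun k : Fin (Fintype.card Λ) => D.val x (D.topo.symm k) := by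
  symm
  apply eq_transcript_of_gate_equations
  · simp
  · intro j hj
    have hj' : j < Fintype.card Λ := by simpa using hj
    rw [D.compile_getElem hj]
    rw [List.getD_eq_getElem?_getD, List.getElem?_ofFn]
    simp only [hj', ↓reduceDIte, Option.getD_some]
    rw [val_eq]
    unfold gateValue
    refine congrArg (D.fn _).2 (funext fun a => ?_)
    rw [cgate_args]
    cases hw : D.args (D.topo.symm ⟨j, hj'⟩) a with
    | inl i => rfl
    | inr m =>
      simp only [wire_inr, cwire_inr, wireVal]
      rw [List.getD_eq_getElem?_getD, List.getElem?_ofFn]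
      simp

/-- **Compilation is correct**: the compiled program computes the value of the output wire.
[folklore] -/
theorem compile_eval (x : ι → Bool) : D.compile.eval x = D.evalOut x := by
  rw [eval_eq_wireVal, transcript_compile, compile_output, evalOut]
  cases D.out with
  | inl i => rfl
  | inr m =>
    simp only [cwire_inr, wireVal, wire_inr]
    rw [List.getD_eq_getElem?_getD, List.getElem?_ofFn]
    simp

/-- The compiled program is over any basis containing the DAG's gate functions. [folklore] -/
theorem compile_isOver {B : Set GateFn} (h : ∀ l, D.fn l ∈ B) : D.compile.IsOver B := by
  intro g hg
  simp only [compile, List.mem_ofFn] at hg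
  obtain ⟨k, rfl⟩ := hg
  exact h _

/-- The compiled program is simply wired iff every DAG gate reads pairwise distinct wires.
[folklore] -/
theorem compile_hasSimpleWiring (h : ∀ l, Function.Injective (D.args l)) :
    D.compile.HasSimpleWiring := by
  intro j
  rw [Fin.getElem_fin, Gate.injective_args_iff_of_eq (D.compile_getElem j.2)]
  intro a b hab
  exact h _ (D.cwire_injective hab)

end Compile

/-! ### Automorphisms of a DAG circuit -/

/-- **Automorphism of a DAG circuit over a map `π` of the inputs**: a bijection `θ` of the gates
fixing the output wire, preserving gate functions, and carrying the argument list of `l`,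
relabelled by `π ⊕ θ`, to a permutation of the argument list of `θ l` — the DAG form of
`Circuit.IsInducedAut` (Anderson–Dawar 2017, Def. 6; Dawar–Wilsenach 2025, Def. 3.6).
[cite: AndersonDawar2016, Def. 6] -/
structure IsAut (π : ι → ι) (θ : Λ ≃ Λ) : Prop where
  /-- The output wire is fixed. -/
  out_eq : D.out.map π θ = D.out
  /-- Gate functions are preserved. -/
  fn_eq : ∀ l, D.fn (θ l) = D.fn l
  /-- Argument lists are permuted and relabelled. -/
  args_perm : ∀ l, (List.ofFn (D.args (θ l))).Perm ((List.ofFn (D.args l)).map (Sum.map π θ))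

/-- The identity is an automorphism over the identity. [folklore] -/
theorem isAut_id_refl : D.IsAut _root_.id (Equiv.refl Λ) := by
  refine ⟨?_, fun l => rfl, fun l => ?_⟩
  · cases D.out <;> rfl
  · have : Sum.map (_root_.id : ι → ι) (⇑(Equiv.refl Λ)) = _root_.id := by
      funext w; cases w <;> rfl
    rw [this, List.map_id]
    exact List.Perm.refl _

/-- Automorphisms compose (over the composite input map). [folklore] -/
theorem IsAut.trans {π π' : ι → ι} {θ θ' : Λ ≃ Λ} (h : D.IsAut π θ) (h' : D.IsAut π' θ') :
    D.IsAut (π' ∘ π) (θ.trans θ') := by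
  have hcomp : Sum.map (π' ∘ π) (⇑(θ.trans θ')) = Sum.map π' (⇑θ') ∘ Sum.map π (⇑θ) := by
    funext w; cases w <;> rfl
  refine ⟨?_, fun l => ?_, fun l => ?_⟩
  · rw [hcomp, Function.comp_apply, h.out_eq, h'.out_eq]
  · rw [Equiv.trans_apply, h'.fn_eq, h.fn_eq]
  · rw [Equiv.trans_apply, hcomp, ← List.map_map]
    exact (h'.args_perm (θ l)).trans ((h.args_perm l).map _)

/-- Automorphisms invert (over the inverse input permutation). [folklore] -/
theorem IsAut.symm {π : Equiv.Perm ι} {θ : Λ ≃ Λ} (h : D.IsAut π θ) : D.IsAut π.symm θ.symm := by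
  have hcomp : Sum.map (⇑π.symm) (⇑θ.symm) ∘ Sum.map (⇑π) (⇑θ) = _root_.id := by
    funext w; cases w <;> simp
  have hcomp' : Sum.map (⇑π) (⇑θ) ∘ Sum.map (⇑π.symm) (⇑θ.symm) = _root_.id := by
    funext w; cases w <;> simp
  refine ⟨?_, fun l => ?_, fun l => ?_⟩
  · conv_lhs => rw [← h.out_eq]
    rw [← Function.comp_apply (f := Sum.map _ _), hcomp]; rfl
  · conv_rhs => rw [← Equiv.apply_symm_apply θ l]
    rw [h.fn_eq]
  · have := (h.args_perm (θ.symm l)).symm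
    rw [Equiv.apply_symm_apply] at this
    have h2 := this.map (Sum.map (⇑π.symm) (⇑θ.symm))
    rw [List.map_map, hcomp, List.map_id] at h2
    exact h2

/-- The value of gate `θ l` on `x` is the value of `l` on `x ∘ π`, for an automorphism over `π`
of a DAG all of whose gate functions are symmetric ("symmetry implies invariance",
Anderson–Dawar 2017, §2.2). [cite: AndersonDawar2016, §2.2] -/
theorem IsAut.val_apply {π : ι → ι} {θ : Λ ≃ Λ} (h : D.IsAut π θ)
    (hsym : ∀ l, (D.fn l).IsSymmetric) (x : ι → Bool) (l : Λ) :
    D.val x (θ l) = D.val (x ∘ π) l := by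
  induction l using D.wf.induction with
  | _ l ih =>
    rw [D.val_eq, D.val_eq]
    refine GateFn.apply_eq_of_eq (h.fn_eq l) (hsym l) ?_
    refine Circuit.numOnes_eq_of_perm_map (h.args_perm l) fun a => ?_
    cases ha : D.args l a with
    | inl i => rfl
    | inr m => exact ih m ⟨a, ha⟩

/-- The orbit of a gate under the automorphisms over input maps from `P`. [Dawar–Wilsenach 2025,
§3.2 (Orb(g))] [cite: DawarWilsenach2025, §3.2 (Orb(g))] -/
def orbit (P : Set (ι → ι)) (l : Λ) : Set Λ :=
  {l' | ∃ π ∈ P, ∃ θ : Λ ≃ Λ, D.IsAut π θ ∧ θ l = l'}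

/-- Membership in an orbit, unfolded. [folklore] -/
theorem mem_orbit_iff {P : Set (ι → ι)} {l l' : Λ} :
    l' ∈ D.orbit P l ↔ ∃ π ∈ P, ∃ θ : Λ ≃ Λ, D.IsAut π θ ∧ θ l = l' := Iff.rfl

/-- Orbits are monotone in the set of input maps. [folklore] -/
theorem orbit_mono {P P' : Set (ι → ι)} (hP : P ⊆ P') (l : Λ) : D.orbit P l ⊆ D.orbit P' l := by
  rintro l' ⟨π, hπ, θ, hθ, rfl⟩
  exact ⟨π, hP hπ, θ, hθ, rfl⟩

/-- `D` is symmetric under `P`: every input map in `P` extends to an automorphism.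
[Dawar–Wilsenach 2025, Def. 3.7] [cite: DawarWilsenach2025, Def. 3.7] -/
def IsSymm (P : Set (ι → ι)) : Prop := ∀ π ∈ P, ∃ θ : Λ ≃ Λ, D.IsAut π θ

/-- `D` is rigid: over every input map there is at most one automorphism. [Dawar–Wilsenach 2025,
Def. 3.6 (rigid)] [cite: DawarWilsenach2025, Def. 3.6 (rigid)] -/
def IsRigidDAG (D : GateDAG ι Λ) : Prop :=
  ∀ (π : ι → ι) (θ θ' : Λ ≃ Λ), D.IsAut π θ → D.IsAut π θ' → θ = θ'

/-- `D` is REDUCED: no two distinct gates have the same gate function and the same multiset of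
argument wires (Anderson–Dawar 2017, Def. 8, without the output clause). [cite: AndersonDawar2016, Def. 8] -/
def Reduced (D : GateDAG ι Λ) : Prop :=
  ∀ l l' : Λ, D.fn l = D.fn l' → (List.ofFn (D.args l)).Perm (List.ofFn (D.args l')) → l = l'

/-- **Reduced circuits are rigid** (Anderson–Dawar 2017, Prop. 9): two automorphisms over the
same input map agree, by well-founded induction along the wires — both images of `l` have the
gate function of `l` and, by induction, the same multiset of argument wires.
[cite: AndersonDawar2016, Prop. 9] -/
theorem IsAut.unique (hR : D.Reduced) {π : ι → ι} {θ θ' : Λ ≃ Λ} (h : D.IsAut π θ)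
    (h' : D.IsAut π θ') : θ = θ' := by
  apply Equiv.ext
  intro l
  induction l using D.wf.induction with
  | _ l ih =>
    apply hR
    · rw [h.fn_eq, h'.fn_eq]
    · have hmap : (List.ofFn (D.args l)).map (Sum.map π θ) =
          (List.ofFn (D.args l)).map (Sum.map π θ') := by
        apply List.map_congr_left
        intro w hw
        rw [List.mem_ofFn] at hw
        obtain ⟨a, rfl⟩ := hw
        cases ha : D.args l a with
        | inl i => rfl
        | inr m => simp only [Sum.map_inr, ih m ⟨a, ha⟩]
      exact ((h.args_perm l).trans (hmap ▸ (h'.args_perm l).symm))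

/-- Reduced circuits are rigid. [cite: AndersonDawar2016, Prop. 9] -/
theorem Reduced.isRigidDAG (hR : D.Reduced) : D.IsRigidDAG := fun _ _ _ h h' => h.unique D hR h'

/-- In a symmetric reduced circuit the orbit of a gate is traced out by ANY family of
automorphisms covering `P` (all automorphisms over a given `π` coincide). [folklore] -/
theorem orbit_subset_of_witness (hR : D.Reduced) {P : Set (ι → ι)}
    (W : (ι → ι) → (Λ ≃ Λ) → Prop) (hW : ∀ π ∈ P, ∃ θ, W π θ ∧ D.IsAut π θ) (l : Λ) :
    D.orbit P l ⊆ {l' | ∃ π ∈ P, ∃ θ, W π θ ∧ θ l = l'} := by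
  rintro l' ⟨π, hπ, θ, hθ, rfl⟩
  obtain ⟨θ', hW', hθ'⟩ := hW π hπ
  exact ⟨π, hπ, θ', hW', by rw [hθ.unique D hR hθ']⟩

/-! ### Automorphisms, symmetry, rigidity and orbits of the compiled program -/

section CompileAut

variable [Fintype Λ]

/-- The position of a DAG gate in the compiled program. [folklore] -/
def posC : Λ ≃ Fin D.compile.gates.length :=
  D.topo.trans (finCongr D.compile_gates_length.symm)

/-- `posC` as a number is `topo`. [folklore] -/
@[simp] theorem coe_posC (l : Λ) : (D.posC l : ℕ) = D.topo l := rfl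

/-- The gate at the position of `l` is the compiled gate of `l`. [folklore] -/
theorem compile_getElem_posC (l : Λ) : D.compile.gates[D.posC l] = D.cgate l := by
  rw [Fin.getElem_fin, D.compile_getElem (D.posC l).2]
  congr 1
  apply D.topo.symm_apply_eq.2
  ext; rfl

/-- The DAG gate at a position. [folklore] -/
theorem posC_symm_eq (j : Fin D.compile.gates.length) :
    D.posC.symm j = D.topo.symm ⟨j, by simpa using j.2⟩ := by
  apply D.posC.symm_apply_eq.2
  apply Fin.ext
  show (j : ℕ) = D.topo (D.topo.symm _)
  rw [Equiv.apply_symm_apply]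

/-- Relabelling compiled wires by `σ` is compiling wires relabelled by the conjugate `θ`.
[folklore] -/
theorem relabelWire_cwire (π : ι → ι) (σ : Equiv.Perm (Fin D.compile.gates.length)) (w : ι ⊕ Λ) :
    Circuit.relabelWire π σ (D.cwire w) =
      D.cwire (Sum.map π (⇑(D.posC.trans (σ.trans D.posC.symm))) w) := by
  cases w with
  | inl i => rfl
  | inr m =>
    have h1 : Circuit.relabelGate σ (D.topo m : ℕ) = (σ (D.posC m) : ℕ) := by
      rw [Circuit.relabelGate_of_lt σ (by rw [compile_gates_length]; exact (D.topo m).2)]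
      rfl
    have h2 : ((D.topo ((D.posC.trans (σ.trans D.posC.symm)) m)) : ℕ) = (σ (D.posC m) : ℕ) := by
      show ((D.topo (D.topo.symm _)) : ℕ) = _
      rw [Equiv.apply_symm_apply]; rfl
    rw [cwire_inr, Circuit.relabelWire_inr, h1, Sum.map_inr, cwire_inr, h2]

/-- The argument list of a compiled gate. [folklore] -/
theorem ofFn_cgate_args (l : Λ) :
    List.ofFn (D.cgate l).args = (List.ofFn (D.args l)).map D.cwire := by
  rw [List.map_ofFn]; rfl

/-- **Automorphisms of the compiled program are exactly the (conjugates of) automorphisms of the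
DAG.** [cite: AndersonDawar2016, Def. 6] -/
theorem isInducedAut_compile_iff (π : ι → ι) (σ : Equiv.Perm (Fin D.compile.gates.length)) :
    D.compile.IsInducedAut π σ ↔ D.IsAut π (D.posC.trans (σ.trans D.posC.symm)) := by
  set θ := D.posC.trans (σ.trans D.posC.symm) with hθ
  have hθl : ∀ l, θ l = D.posC.symm (σ (D.posC l)) := fun l => rfl
  have hgate : ∀ j : Fin D.compile.gates.length, D.compile.gates[j] = D.cgate (D.posC.symm j) := by
    intro j
    rw [Fin.getElem_fin, D.compile_getElem j.2, posC_symm_eq]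
  have hc : Circuit.relabelWire π σ ∘ D.cwire = D.cwire ∘ Sum.map π (⇑θ) := by
    funext w; exact D.relabelWire_cwire π σ w
  constructor
  · rintro ⟨hout, hg⟩
    refine ⟨?_, fun l => ?_, fun l => ?_⟩
    · apply D.cwire_injective
      rw [← D.relabelWire_cwire π σ]
      exact hout
    · have := (hg (D.posC l)).1
      rw [hgate, hgate, cgate_fn, cgate_fn, Equiv.symm_apply_apply] at this
      rw [hθl]; exact this
    · have := (hg (D.posC l)).2
      rw [Gate.ofFn_args_eq_of_eq (hgate _), Gate.ofFn_args_eq_of_eq (hgate _),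
        Equiv.symm_apply_apply, ofFn_cgate_args, ofFn_cgate_args, List.map_map, hc,
        ← List.map_map] at this
      rw [hθl]
      exact (List.map_perm_map_iff D.cwire_injective).1 this
  · intro h
    refine ⟨?_, fun j => ⟨?_, ?_⟩⟩
    · rw [compile_output, D.relabelWire_cwire, ← hθ, h.out_eq]
    · rw [hgate, hgate, cgate_fn, cgate_fn]
      have := h.fn_eq (D.posC.symm j)
      rwa [show θ (D.posC.symm j) = D.posC.symm (σ j) by simp [hθ]] at this
    · rw [Gate.ofFn_args_eq_of_eq (hgate (σ j)), Gate.ofFn_args_eq_of_eq (hgate j),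
        ofFn_cgate_args, ofFn_cgate_args, List.map_map]
      have hc : Circuit.relabelWire π σ ∘ D.cwire = D.cwire ∘ Sum.map π (⇑θ) := by
        funext w; exact D.relabelWire_cwire π σ w
      rw [hc, ← List.map_map]
      apply (List.map_perm_map_iff D.cwire_injective).2
      have := h.args_perm (D.posC.symm j)
      rwa [show θ (D.posC.symm j) = D.posC.symm (σ j) by simp [hθ]] at this

/-- The compiled program admits the automorphism compiled from a DAG automorphism. [folklore] -/
theorem IsAut.isInducedAut_compile {π : ι → ι} {θ : Λ ≃ Λ} (h : D.IsAut π θ) :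
    D.compile.IsInducedAut π (D.posC.symm.trans (θ.trans D.posC)) := by
  rw [isInducedAut_compile_iff]
  convert h using 1
  ext l; simp

/-- The sets of input maps singled out by a set `Γ` of permutations of `Fin m` acting diagonally on
matrix inputs `Fin m × Fin m`. [Dawar–Wilsenach 2025, §3.2 (square-symmetric)] [folklore] -/
def diagMaps {m : ℕ} (Γ : Set (Equiv.Perm (Fin m))) : Set (Fin m × Fin m → Fin m × Fin m) :=
  {π | ∃ ρ ∈ Γ, π = fun q => (ρ q.1, ρ q.2)}

/-- Diagonal maps of members of `Γ` are in `diagMaps Γ`. [folklore] -/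
theorem diag_mem_diagMaps {m : ℕ} {Γ : Set (Equiv.Perm (Fin m))} {ρ : Equiv.Perm (Fin m)} (hρ : ρ ∈ Γ) :
    (fun q : Fin m × Fin m => (ρ q.1, ρ q.2)) ∈ diagMaps Γ := ⟨ρ, hρ, rfl⟩

variable {m : ℕ} (E : GateDAG (Fin m × Fin m) Λ)

/-- **Symmetry of the compiled program** is symmetry of the DAG. [cite: DawarWilsenach2025, Def. 3.7] -/
theorem isSymmetricUnder_compile_iff (Γ : Set (Equiv.Perm (Fin m))) :
    E.compile.IsSymmetricUnder Γ ↔ E.IsSymm (diagMaps Γ) := by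
  constructor
  · rintro h π ⟨ρ, hρ, rfl⟩
    obtain ⟨σ, hσ⟩ := h ρ hρ
    exact ⟨_, (E.isInducedAut_compile_iff _ σ).1 hσ⟩
  · intro h ρ hρ
    obtain ⟨θ, hθ⟩ := h _ (diag_mem_diagMaps hρ)
    exact ⟨_, hθ.isInducedAut_compile⟩

/-- **Rigidity of the compiled program** follows from rigidity of the DAG. [cite: DawarWilsenach2025, Def. 3.6 (rigid)] -/
theorem compile_isRigid (D : GateDAG ι Λ) (h : D.IsRigidDAG) : D.compile.IsRigid := by
  intro π σ σ' hσ hσ'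
  rw [isInducedAut_compile_iff] at hσ hσ'
  have := h _ _ _ hσ hσ'
  ext j
  have hj := Equiv.ext_iff.1 this (D.posC.symm j)
  simp only [Equiv.trans_apply, Equiv.apply_symm_apply] at hj
  exact congrArg Fin.val (D.posC.symm.injective hj)

/-- **Gate orbits of the compiled program are the images of the DAG orbits.**
[cite: DawarWilsenach2025, §3.2 (Orb(g))] -/
theorem gateOrbit_compile (Γ : Set (Equiv.Perm (Fin m))) (l : Λ) :
    E.compile.gateOrbit Γ (E.posC l) = E.posC '' E.orbit (diagMaps Γ) l := by
  ext j'
  rw [Circuit.mem_gateOrbit_iff, Set.mem_image]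
  constructor
  · rintro ⟨ρ, hρ, σ, hσ, rfl⟩
    rw [isInducedAut_compile_iff] at hσ
    exact ⟨_, ⟨_, diag_mem_diagMaps hρ, _, hσ, rfl⟩, by simp⟩
  · rintro ⟨l', ⟨π, ⟨ρ, hρ, rfl⟩, θ, hθ, rfl⟩, rfl⟩
    exact ⟨ρ, hρ, _, hθ.isInducedAut_compile, by simp⟩

/-- Hence the orbit sizes agree gate by gate … [folklore] -/
theorem ncard_gateOrbit_compile (Γ : Set (Equiv.Perm (Fin m))) (l : Λ) :
    (E.compile.gateOrbit Γ (E.posC l)).ncard = (E.orbit (diagMaps Γ) l).ncard := by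
  rw [gateOrbit_compile, Set.ncard_image_of_injective _ E.posC.injective]

/-- … and **the orbit size of the compiled program is the maximal DAG orbit**.
[cite: DawarWilsenach2025, §3.2 (ORB(C))] -/
theorem orbitSize_compile (Γ : Set (Equiv.Perm (Fin m))) :
    E.compile.orbitSize Γ = univ.sup fun l => (E.orbit (diagMaps Γ) l).ncard := by
  unfold Circuit.orbitSize
  apply le_antisymm
  · refine Finset.sup_le fun j _ => ?_
    have := E.ncard_gateOrbit_compile Γ (E.posC.symm j)
    rw [Equiv.apply_symm_apply] at this
    rw [this]
    exact Finset.le_sup (f := fun l => (E.orbit (diagMaps Γ) l).ncard) (mem_univ _)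
  · refine Finset.sup_le fun l _ => ?_
    rw [← E.ncard_gateOrbit_compile Γ l]
    exact Finset.le_sup (f := fun j => (E.compile.gateOrbit Γ j).ncard) (mem_univ _)

/-- A bound on all DAG orbits bounds the orbit size of the compiled program. [folklore] -/
theorem orbitSize_compile_le (Γ : Set (Equiv.Perm (Fin m))) {s : ℕ}
    (h : ∀ l, (E.orbit (diagMaps Γ) l).ncard ≤ s) : E.compile.orbitSize Γ ≤ s := by
  rw [orbitSize_compile]
  exact Finset.sup_le fun l _ => h l

end CompileAut

/-! ### Straight-line programs as DAGs -/

section OfCircuit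

variable (C : Circuit ι)

/-- The wires of a straight-line program with in-range back-references made explicit.
[folklore] -/
def finWire (n : ℕ) : ι ⊕ Fin n → ι ⊕ ℕ := Sum.map id Fin.val

/-- `finWire` is injective. [folklore] -/
theorem finWire_injective (n : ℕ) : Function.Injective (finWire (ι := ι) n) :=
  Sum.map_injective.2 ⟨Function.injective_id, Fin.val_injective⟩

/-- **A straight-line program read as a DAG** on its set of positions. [Arora–Barak 2009,
Rem. 6.4] [folklore] -/
def ofCircuit : GateDAG ι (Fin C.gates.length) where
  fn k := (C.gates[(k : ℕ)]).fn
  args k a :=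
    match h : (C.gates[(k : ℕ)]).args a with
    | .inl i => .inl i
    | .inr m => .inr ⟨m, (C.wf k k.2 a m h).trans k.2⟩
  out :=
    match h : C.output with
    | .inl i => .inl i
    | .inr m => .inr ⟨m, C.wf_output m h⟩
  wf := by
    refine Subrelation.wf ?_ (wellFounded_lt (α := Fin C.gates.length))
    rintro m l ⟨a, ha⟩
    split at ha
    · exact absurd ha Sum.inl_ne_inr
    · rename_i m' hm'
      rw [Sum.inr.injEq] at ha
      rw [← ha, Fin.lt_def]
      exact C.wf l l.2 a m' hm'

/-- The wires of the DAG of a program are the program's wires. [folklore] -/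
theorem finWire_ofCircuit_args (k : Fin C.gates.length) (a : Fin (C.gates[(k : ℕ)]).arity) :
    finWire _ ((ofCircuit C).args k a) = (C.gates[(k : ℕ)]).args a := by
  unfold ofCircuit
  dsimp only
  split <;> rename_i h
  · rw [h]; rfl
  · exact h.symm

/-- The output of the DAG of a program is the program's output. [folklore] -/
theorem finWire_ofCircuit_out : finWire _ (ofCircuit C).out = C.output := by
  unfold ofCircuit
  dsimp only
  split <;> rename_i h
  · rw [h]; rfl
  · exact h.symm

/-- The gate functions of the DAG of a program. [folklore] -/
@[simp] theorem ofCircuit_fn (k : Fin C.gates.length) : (ofCircuit C).fn k = (C.gates[(k : ℕ)]).fn := rfl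

/-- The argument lists of the DAG of a program. [folklore] -/
theorem ofFn_ofCircuit_args (k : Fin C.gates.length) :
    (List.ofFn ((ofCircuit C).args k)).map (finWire _) = List.ofFn (C.gates[(k : ℕ)]).args := by
  rw [List.map_ofFn]
  congr 1
  funext a
  exact finWire_ofCircuit_args C k a

/-- A child in the DAG of a program is an earlier position. [folklore] -/
theorem ofCircuit_child_lt {m k : Fin C.gates.length} (h : (ofCircuit C).Child m k) : m < k := by
  obtain ⟨a, ha⟩ := h
  have := finWire_ofCircuit_args C k a
  rw [ha] at this
  exact C.wf k k.2 a m this.symm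

/-- **The DAG of a program has the program's gate values.** [cite: AroraBarak2009, Rem. 6.4] -/
theorem val_ofCircuit (x : ι → Bool) (k : Fin C.gates.length) :
    (ofCircuit C).val x k = (transcript x [] C.gates).getD k false := by
  induction k using (ofCircuit C).wf.induction with
  | _ k ih =>
    rw [val_eq, getD_transcript_eq_gateValue C x k k.2]
    unfold gateValue
    show (C.gates[(k : ℕ)]).op _ = (C.gates[(k : ℕ)]).op _
    congr 1
    funext a
    rw [← finWire_ofCircuit_args C k a]
    cases ha : (ofCircuit C).args k a with
    | inl i => rfl
    | inr m =>
      simp only [wire_inr, finWire, Sum.map_inr, wireVal]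
      exact ih m ⟨a, ha⟩

/-- The DAG of a program computes the program's function. [cite: AroraBarak2009, Def. 6.1] -/
theorem evalOut_ofCircuit (x : ι → Bool) : (ofCircuit C).evalOut x = C.eval x := by
  rw [eval_eq_wireVal, evalOut, ← finWire_ofCircuit_out C]
  cases (ofCircuit C).out with
  | inl i => rfl
  | inr m => simp only [wire_inr, finWire, Sum.map_inr, wireVal]; exact val_ofCircuit C x m

/-- Relabelling commutes with `finWire`. [folklore] -/
theorem relabelWire_finWire (π : ι → ι) (σ : Equiv.Perm (Fin C.gates.length))
    (w : ι ⊕ Fin C.gates.length) :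
    Circuit.relabelWire π σ (finWire _ w) = finWire _ (Sum.map π σ w) := by
  cases w with
  | inl i => rfl
  | inr m =>
    simp only [finWire, Sum.map_inr, Circuit.relabelWire_inr, Sum.inr.injEq]
    rw [Circuit.relabelGate_of_lt σ m.2]

/-- **Automorphisms of a program are exactly the automorphisms of its DAG.**
[cite: AndersonDawar2016, Def. 6] -/
theorem isInducedAut_iff_isAut_ofCircuit (π : ι → ι) (σ : Equiv.Perm (Fin C.gates.length)) :
    C.IsInducedAut π σ ↔ (ofCircuit C).IsAut π σ := by
  have hc : Circuit.relabelWire π σ ∘ finWire _ = finWire _ ∘ Sum.map π (⇑σ) := by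
    funext w; exact relabelWire_finWire C π σ w
  have hargs : ∀ j : Fin C.gates.length,
      ((List.ofFn (C.gates[σ j]).args).Perm ((List.ofFn (C.gates[j]).args).map (Circuit.relabelWire π σ)))
        ↔ (List.ofFn ((ofCircuit C).args (σ j))).Perm
            ((List.ofFn ((ofCircuit C).args j)).map (Sum.map π σ)) := by
    intro j
    rw [Fin.getElem_fin, Fin.getElem_fin, ← ofFn_ofCircuit_args, ← ofFn_ofCircuit_args,
      List.map_map, hc, ← List.map_map, List.map_perm_map_iff (finWire_injective _)]
  constructor
  · rintro ⟨hout, hg⟩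
    refine ⟨?_, fun j => ?_, fun j => (hargs j).1 (hg j).2⟩
    · apply finWire_injective
      rw [← relabelWire_finWire, finWire_ofCircuit_out]
      exact hout
    · have := (hg j).1
      rw [Fin.getElem_fin, Fin.getElem_fin] at this
      exact this
  · intro h
    refine ⟨?_, fun j => ⟨?_, (hargs j).2 (h.args_perm j)⟩⟩
    · rw [← finWire_ofCircuit_out, relabelWire_finWire, h.out_eq]
    · rw [Fin.getElem_fin, Fin.getElem_fin]
      exact h.fn_eq j

/-- The basis of a program is read off its DAG. [folklore] -/
theorem isOver_iff_ofCircuit (B : Set GateFn) : C.IsOver B ↔ ∀ k, (ofCircuit C).fn k ∈ B := by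
  constructor
  · intro h k
    exact h _ (List.getElem_mem k.2)
  · intro h g hg
    obtain ⟨k, hk, rfl⟩ := List.mem_iff_getElem.1 hg
    exact h ⟨k, hk⟩

/-- Simple wiring of a program is injectivity of the argument maps of its DAG. [folklore] -/
theorem hasSimpleWiring_iff_ofCircuit :
    C.HasSimpleWiring ↔ ∀ k, Function.Injective ((ofCircuit C).args k) := by
  have key : ∀ k : Fin C.gates.length,
      Function.Injective (C.gates[(k : ℕ)]).args ↔ Function.Injective ((ofCircuit C).args k) := by
    intro k
    have : (C.gates[(k : ℕ)]).args = finWire _ ∘ (ofCircuit C).args k := by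
      funext a; exact (finWire_ofCircuit_args C k a).symm
    rw [this]
    exact ⟨fun h => h.of_comp, fun h => (finWire_injective _).comp h⟩
  constructor
  · intro h k
    have := h k
    rw [Fin.getElem_fin] at this
    exact (key k).1 this
  · intro h k
    rw [Fin.getElem_fin]
    exact (key k).2 (h k)

variable {m : ℕ} (C' : Circuit (Fin m × Fin m))

/-- Symmetry of a program is symmetry of its DAG. [cite: DawarWilsenach2025, Def. 3.7] -/
theorem isSymmetricUnder_iff_ofCircuit (Γ : Set (Equiv.Perm (Fin m))) :
    C'.IsSymmetricUnder Γ ↔ (ofCircuit C').IsSymm (diagMaps Γ) := by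
  constructor
  · rintro h π ⟨ρ, hρ, rfl⟩
    obtain ⟨σ, hσ⟩ := h ρ hρ
    exact ⟨σ, (isInducedAut_iff_isAut_ofCircuit C' _ σ).1 hσ⟩
  · intro h ρ hρ
    obtain ⟨θ, hθ⟩ := h _ (diag_mem_diagMaps hρ)
    exact ⟨θ, (isInducedAut_iff_isAut_ofCircuit C' _ θ).2 hθ⟩

/-- **Gate orbits of a program are the orbits of its DAG.** [cite: DawarWilsenach2025, §3.2 (Orb(g))] -/
theorem gateOrbit_eq_orbit_ofCircuit (Γ : Set (Equiv.Perm (Fin m))) (j : Fin C'.gates.length) :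
    C'.gateOrbit Γ j = (ofCircuit C').orbit (diagMaps Γ) j := by
  ext j'
  rw [Circuit.mem_gateOrbit_iff, mem_orbit_iff]
  constructor
  · rintro ⟨ρ, hρ, σ, hσ, rfl⟩
    exact ⟨_, diag_mem_diagMaps hρ, σ, (isInducedAut_iff_isAut_ofCircuit C' _ σ).1 hσ, rfl⟩
  · rintro ⟨π, ⟨ρ, hρ, rfl⟩, θ, hθ, rfl⟩
    exact ⟨ρ, hρ, θ, (isInducedAut_iff_isAut_ofCircuit C' _ θ).2 hθ, rfl⟩

/-- The orbit size of a program is the maximal orbit of its DAG. [cite: DawarWilsenach2025, §3.2 (ORB(C))] -/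
theorem orbitSize_eq_ofCircuit (Γ : Set (Equiv.Perm (Fin m))) :
    C'.orbitSize Γ = univ.sup fun j => ((ofCircuit C').orbit (diagMaps Γ) j).ncard := by
  unfold Circuit.orbitSize
  congr 1
  funext j
  rw [gateOrbit_eq_orbit_ofCircuit]

end OfCircuit

end GateDAG

end Literature.Computability.Complexity
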